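import Literature.AlgebraicGeometry.Deligne1982.WeilTypeCMRosatiPolarization
import Mathlib.NumberTheory.NumberField.CMField
import HarnessLib

/-!
# Balanced weights on a CM field: `Σ_j m_j β(ε_j a, ε_j) = Σ_j m_j β(ε_j, ε_j ā)` for every biadditive `β`
# (van Geemen's averaging, [vanGeemen1994HodgeAV] Lemma 5.2 (1); [Deligne1982HodgeCycles] §4 (4.3 a), Sublemma 4.7)

Topic `Literature/NumberTheory/ComplexMultiplication`, namespace `Literature.NumberTheory.ComplexMultiplication`.
THEOREMS ONLY, all proved; no definition, no named fact, no instance (net debt 0).  Cell `hodgecm-mathlib`, row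
II-1-S5b (`exists_balancedDivisor_finiteExtension`), the ALGEBRA HALF «H-alg» of B-typ02's divisor-level averaging
road (bus 2026-08-28T08:05Z): the geometric half builds, from any ample divisor `X₀` on a CM abelian variety
`(A₀, ι₀)` and the weights below, the divisor `X := Σ_j m_j ι₀(ε_j)^* X₀`, and (bal) for the Weil pairings of `X`
is the identity of this file applied to the biadditive map `(x, y) ↦ ē^{X₀}(ι₀(x) P, ι₀(y) Q)`.

THE PRINT.  B. van Geemen, *An introduction to the Hodge conjecture for abelian varieties* (1994), Lemma 5.2 (1)
(proof): a polarisation of a CM abelian variety whose Rosati involution induces complex conjugation is obtained by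
averaging; P. Deligne, *Hodge cycles on abelian varieties* (1982), §4, 4.3 (a) and Sublemma 4.7: the form
`B(x, y) = Tr_{K/ℚ}(x ȳ)` is positive definite and, for a `B`-orthogonal basis `ε_j` with `q_j = 1/B(ε_j, ε_j)`,
`Σ_j q_j τ₁(ε_j) τ₂(ε_j) = [τ₂ = τ₁ ∘ ρ]` for all complex embeddings `τ₁, τ₂` (the tree's
`Deligne1982.exists_sq_weights_of_involution`).

WHAT IS PROVED.  For a CM field `K` (complex conjugation `ρ`, Mathlib `NumberField.IsCMField.complexConj`):

* `IsCMField.exists_ratWeights_embeddings` — the resolution of the identity with `ε_j ∈ 𝓞_K`;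
* `sum_mul_bilin_eq_sum_mul_bilin_conj_of_embeddings` — for every `ℚ`-bilinear `f : K × K → ℂ`, weights as
  above give `Σ_j q_j f(ε_j a, ε_j) = Σ_j q_j f(ε_j, ε_j σa)` (expand both arguments in a trace-dual basis;
  `Tr = Σ_τ τ`; the inner sums are `τ₁(a)·[τ₂ = τ₁σ] = τ₂(σa)·[τ₂ = τ₁σ]`);
* **`IsCMField.exists_balancedWeights`** — there are finitely many NON-ZERO `ε_j ∈ 𝓞_K` and POSITIVE INTEGERS
  `m_j` with `Σ_j m_j • β (ε_j a) (ε_j) = Σ_j m_j • β (ε_j) (ε_j ρa)` for EVERY biadditive `β : 𝓞_K × 𝓞_K → G` into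
  an abelian group and every `a ∈ 𝓞_K` (clear denominators; expand `β` in an integral basis; the coordinate
  forms are `ℚ`-bilinear); `IsCMField.exists_balancedWeights_fin` — the same indexed by `Fin (N + 1)`.

## References
* [vanGeemen1994HodgeAV] B. van Geemen, *An introduction to the Hodge conjecture for abelian varieties*, in:
  Algebraic Cycles and Hodge Theory (Torino 1993), LNM 1594 (1994), Lemma 5.2 (1) and its proof.
* [Deligne1982HodgeCycles] P. Deligne, *Hodge cycles on abelian varieties*, LNM 900 (1982), §4, 4.3 (a), 4.7.
* [Shimura1998] G. Shimura, *Abelian Varieties with Complex Multiplication and Modular Functions* (1998), §6.2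
  Thm. 4 (3) («`E(z, T(ξ)w) = E(T(ξ^ρ)z, w)`», the balancedness the weights produce).
-/

noncomputable section

open NumberField
open scoped ComplexConjugate

namespace Literature.NumberTheory.ComplexMultiplication

open Literature.AlgebraicGeometry.Deligne1982

section BalancedWeights

variable (K : Type) [Field K] [NumberField K] [IsCMField K]

/-- Complex conjugation of the CM field `K` as a `ℚ`-algebra endomorphism: an involution inducing `conj` in
every complex embedding (plumbing for `exists_sq_weights_of_involution`). [cite: Deligne1982HodgeCycles, §4 4.3 (a)] -/
theorem IsCMField.exists_ratAlgHom_complexConj :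
    ∃ σ : K →ₐ[ℚ] K, (∀ x, σ x = IsCMField.complexConj K x) ∧ (∀ x, σ (σ x) = x) ∧
      ∀ (τ : K →ₐ[ℚ] ℂ) (x : K), τ (σ x) = starRingEnd ℂ (τ x) := by
  refine ⟨((IsCMField.complexConj K : K ≃ₐ[maximalRealSubfield K] K) : K →+* K).toRatAlgHom, fun x => rfl,
    fun x => IsCMField.complexConj_apply_apply K x, fun τ x => ?_⟩
  change (τ : K →+* ℂ) (IsCMField.complexConj K x) = _
  exact IsCMField.complexEmbedding_complexConj K (τ : K →+* ℂ) x

/-- **The resolution of the identity with integral `ε_j`** ([Deligne1982HodgeCycles] Sublemma 4.7 for the CM field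
`K` with `σ := ρ` and `S := 𝓞_K`): there are `ε_0, …, ε_n ∈ 𝓞_K` and positive rationals `q_j` with
`Σ_j q_j τ₁(ε_j) τ₂(ε_j) = [τ₂ = τ₁ ∘ ρ]` for all complex embeddings `τ₁, τ₂`.
[cite: Deligne1982HodgeCycles, §4 4.3 (a) and Sublemma 4.7] [cite: vanGeemen1994HodgeAV, Lemma 5.2 (1) (proof)] -/
theorem IsCMField.exists_ratWeights_embeddings :
    ∃ (σ : K →ₐ[ℚ] K) (n : ℕ) (ε : Fin (n + 1) → 𝓞 K) (q : Fin (n + 1) → ℚ),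
      (∀ x, σ x = IsCMField.complexConj K x) ∧ (∀ x, σ (σ x) = x) ∧ (∀ j, 0 < q j) ∧
      ∀ τ₁ τ₂ : K →ₐ[ℚ] ℂ,
        (τ₂ = τ₁.comp σ → ∑ j, (q j : ℂ) * τ₁ (ε j) * τ₂ (ε j) = 1) ∧
        (τ₂ ≠ τ₁.comp σ → ∑ j, (q j : ℂ) * τ₁ (ε j) * τ₂ (ε j) = 0) := by
  classical
  obtain ⟨σ, hσeq, hσ, hτσ⟩ := IsCMField.exists_ratAlgHom_complexConj K
  -- every element of `K` has a non-zero integer multiple in `𝓞 K`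
  have hS : ∀ e : K, ∃ d : ℤ, d ≠ 0 ∧ (d : ℚ) • e ∈ Set.range ((↑) : 𝓞 K → K) := by
    intro e
    obtain ⟨y, hy0, hy⟩ := exists_integral_multiples ℤ ℚ ({e} : Finset K)
    refine ⟨y, hy0, ⟨⟨y • e, (mem_integralClosure_iff ℤ K).2 (hy e (Finset.mem_singleton_self e))⟩, ?_⟩⟩
    rw [Int.cast_smul_eq_zsmul]
    rfl
  obtain ⟨n, ε, q, -, hεS, hq, hid⟩ := exists_sq_weights_of_involution hσ hτσ
    (Set.range ((↑) : 𝓞 K → K)) ⟨1, rfl⟩ hS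
  choose ε' hε' using hεS
  refine ⟨σ, n, ε', q, hσeq, hσ, hq, fun τ₁ τ₂ => ?_⟩
  simp only [hε']
  exact hid τ₁ τ₂

variable {K}

/-- **The balance identity for `ℚ`-bilinear forms.**  Let `σ` be an involution of the number field `K` and
`ε_j ∈ K`, `q_j ∈ ℚ` with `Σ_j q_j τ₁(ε_j) τ₂(ε_j) = [τ₂ = τ₁ ∘ σ]` for all complex embeddings.  Then for every
`ℚ`-bilinear `f : K × K → ℂ` and every `a ∈ K`: `Σ_j q_j f(ε_j a, ε_j) = Σ_j q_j f(ε_j, ε_j σ(a))`.  PROOF: expand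
both arguments of `f` in the basis dual to a `ℚ`-basis `b` for the trace form, `x = Σ_i Tr(x b_i) d_i`, and write
`Tr = Σ_τ τ` (`ratCast_trace_eq_sum_embeddings`): `f(x, y) = Σ c · τ₁(x) τ₂(y)`; on each term both sides equal
`c · τ₁(a) · [τ₂ = τ₁σ]`. [cite: vanGeemen1994HodgeAV, Lemma 5.2 (1) (proof)] [cite: Deligne1982HodgeCycles, §4 4.3 (a)] -/
theorem sum_mul_bilin_eq_sum_mul_bilin_conj_of_embeddings {K : Type} [Field K] [NumberField K]
    {σ : K →ₐ[ℚ] K} (hσ : ∀ x, σ (σ x) = x) {n : ℕ} {ε : Fin (n + 1) → K} {q : Fin (n + 1) → ℚ}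
    (hid : ∀ τ₁ τ₂ : K →ₐ[ℚ] ℂ,
      (τ₂ = τ₁.comp σ → ∑ j, (q j : ℂ) * τ₁ (ε j) * τ₂ (ε j) = 1) ∧
      (τ₂ ≠ τ₁.comp σ → ∑ j, (q j : ℂ) * τ₁ (ε j) * τ₂ (ε j) = 0))
    (f : K →ₗ[ℚ] K →ₗ[ℚ] ℂ) (a : K) :
    ∑ j, (q j : ℂ) * f (ε j * a) (ε j) = ∑ j, (q j : ℂ) * f (ε j) (ε j * σ a) := by
  classical
  -- the inner sums over `j`, for each pair of embeddings
  have hinner : ∀ τ₁ τ₂ : K →ₐ[ℚ] ℂ,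
      ∑ j, (q j : ℂ) * (τ₁ (ε j * a) * τ₂ (ε j)) = ∑ j, (q j : ℂ) * (τ₁ (ε j) * τ₂ (ε j * σ a)) := by
    intro τ₁ τ₂
    have hL : ∑ j, (q j : ℂ) * (τ₁ (ε j * a) * τ₂ (ε j)) = τ₁ a * ∑ j, (q j : ℂ) * τ₁ (ε j) * τ₂ (ε j) := by
      rw [Finset.mul_sum]
      exact Finset.sum_congr rfl fun j _ => by rw [map_mul]; ring
    have hR : ∑ j, (q j : ℂ) * (τ₁ (ε j) * τ₂ (ε j * σ a)) =
        τ₂ (σ a) * ∑ j, (q j : ℂ) * τ₁ (ε j) * τ₂ (ε j) := by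
      rw [Finset.mul_sum]
      exact Finset.sum_congr rfl fun j _ => by rw [map_mul]; ring
    rw [hL, hR]
    by_cases h : τ₂ = τ₁.comp σ
    · rw [(hid τ₁ τ₂).1 h, h, AlgHom.comp_apply, hσ]
    · rw [(hid τ₁ τ₂).2 h, mul_zero, mul_zero]
  -- a trace-dual basis: `x = Σ_i Tr(x b_i) • d_i`
  let b := Module.finBasis ℚ K
  have hB : (Algebra.traceForm ℚ K).Nondegenerate := traceForm_nondegenerate ℚ K
  let d := (Algebra.traceForm ℚ K).dualBasis hB b
  have hexp : ∀ x : K, x = ∑ i, (Algebra.trace ℚ K (x * b i)) • d i := fun x => by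
    conv_lhs => rw [← d.sum_repr x]
    exact Finset.sum_congr rfl fun i _ => by
      rw [LinearMap.BilinForm.dualBasis_repr_apply, Algebra.traceForm_apply]
  have htr : ∀ z : K, ((Algebra.trace ℚ K z : ℚ) : ℂ) = ∑ τ : K →ₐ[ℚ] ℂ, τ z :=
    ratCast_trace_eq_sum_embeddings
  -- expansion of `f x y` through the embeddings
  let C : Fin (Module.finrank ℚ K) → Fin (Module.finrank ℚ K) → (K →ₐ[ℚ] ℂ) → (K →ₐ[ℚ] ℂ) → ℂ :=
    fun i k τ₁ τ₂ => τ₁ (b i) * τ₂ (b k) * f (d i) (d k)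
  have hf : ∀ x y : K, f x y =
      ∑ i, ∑ k, ∑ τ₁ : K →ₐ[ℚ] ℂ, ∑ τ₂ : K →ₐ[ℚ] ℂ, C i k τ₁ τ₂ * (τ₁ x * τ₂ y) := by
    intro x y
    conv_lhs => rw [hexp x]
    rw [map_sum, LinearMap.sum_apply]
    refine Finset.sum_congr rfl fun i _ => ?_
    rw [LinearMap.map_smul, LinearMap.smul_apply]
    conv_lhs => rw [hexp y]
    rw [map_sum, Finset.smul_sum]
    refine Finset.sum_congr rfl fun k _ => ?_
    rw [LinearMap.map_smul, Rat.smul_def, Rat.smul_def, htr, htr]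
    simp only [C, map_mul, Finset.sum_mul, Finset.mul_sum]
    rw [Finset.sum_comm]
    exact Finset.sum_congr rfl fun τ₁ _ => Finset.sum_congr rfl fun τ₂ _ => by ring
  -- moving the sum over `j` inside
  have hswap : ∀ g : Fin (n + 1) → (K →ₐ[ℚ] ℂ) → (K →ₐ[ℚ] ℂ) → ℂ,
      ∑ j, (q j : ℂ) * ∑ i, ∑ k, ∑ τ₁ : K →ₐ[ℚ] ℂ, ∑ τ₂ : K →ₐ[ℚ] ℂ, C i k τ₁ τ₂ * g j τ₁ τ₂ =
        ∑ i, ∑ k, ∑ τ₁ : K →ₐ[ℚ] ℂ, ∑ τ₂ : K →ₐ[ℚ] ℂ, C i k τ₁ τ₂ * ∑ j, (q j : ℂ) * g j τ₁ τ₂ := by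
    intro g
    simp only [Finset.mul_sum]
    rw [Finset.sum_comm]
    refine Finset.sum_congr rfl fun i _ => ?_
    rw [Finset.sum_comm]
    refine Finset.sum_congr rfl fun k _ => ?_
    rw [Finset.sum_comm]
    refine Finset.sum_congr rfl fun τ₁ _ => ?_
    rw [Finset.sum_comm]
    exact Finset.sum_congr rfl fun τ₂ _ => Finset.sum_congr rfl fun j _ => by ring
  calc ∑ j, (q j : ℂ) * f (ε j * a) (ε j)
      = ∑ j, (q j : ℂ) * ∑ i, ∑ k, ∑ τ₁ : K →ₐ[ℚ] ℂ, ∑ τ₂ : K →ₐ[ℚ] ℂ,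
          C i k τ₁ τ₂ * (τ₁ (ε j * a) * τ₂ (ε j)) :=
        Finset.sum_congr rfl fun j _ => by rw [hf]
    _ = ∑ i, ∑ k, ∑ τ₁ : K →ₐ[ℚ] ℂ, ∑ τ₂ : K →ₐ[ℚ] ℂ,
          C i k τ₁ τ₂ * ∑ j, (q j : ℂ) * (τ₁ (ε j * a) * τ₂ (ε j)) :=
        hswap fun j τ₁ τ₂ => τ₁ (ε j * a) * τ₂ (ε j)
    _ = ∑ i, ∑ k, ∑ τ₁ : K →ₐ[ℚ] ℂ, ∑ τ₂ : K →ₐ[ℚ] ℂ,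
          C i k τ₁ τ₂ * ∑ j, (q j : ℂ) * (τ₁ (ε j) * τ₂ (ε j * σ a)) := by
        simp_rw [hinner]
    _ = ∑ j, (q j : ℂ) * ∑ i, ∑ k, ∑ τ₁ : K →ₐ[ℚ] ℂ, ∑ τ₂ : K →ₐ[ℚ] ℂ,
          C i k τ₁ τ₂ * (τ₁ (ε j) * τ₂ (ε j * σ a)) :=
        (hswap fun j τ₁ τ₂ => τ₁ (ε j) * τ₂ (ε j * σ a)).symm
    _ = ∑ j, (q j : ℂ) * f (ε j) (ε j * σ a) :=
        Finset.sum_congr rfl fun j _ => by rw [hf]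

/-- **Balanced weights on a CM field** (van Geemen's averaging, integral form).  For a CM field `K` with complex
conjugation `ρ` there are finitely many non-zero `ε_j ∈ 𝓞_K` and positive integers `m_j` such that
`Σ_j m_j • β(ε_j a, ε_j) = Σ_j m_j • β(ε_j, ε_j ρ(a))` for every biadditive map `β : 𝓞_K × 𝓞_K → G` into an abelian
group and every `a ∈ 𝓞_K`.  PROOF: the rational weights of `exists_ratWeights_embeddings` with denominators
cleared (`m_j := D q_j`) and the zero `ε_j` discarded; for the coordinate forms of an integral basis (which are
`ℚ`-bilinear on `K`) the identity is `sum_mul_bilin_eq_sum_mul_bilin_conj_of_embeddings`, and every `β` is an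
integral combination of them (`Basis.sum_repr`).  Use (row II-1-S5b, (bal)): `β(x, y) := ē^{X₀}(ι₀(x)P, ι₀(y)Q)`.
[cite: vanGeemen1994HodgeAV, Lemma 5.2 (1) (proof)] [cite: Deligne1982HodgeCycles, §4 4.3 (a) and Sublemma 4.7]
[cite: Shimura1998, §6.2 Thm. 4 (3)] -/
theorem IsCMField.exists_balancedWeights (K : Type) [Field K] [NumberField K] [IsCMField K] :
    ∃ (ι : Type) (_ : Fintype ι) (ε : ι → 𝓞 K) (m : ι → ℕ), Nonempty ι ∧ (∀ j, ε j ≠ 0) ∧ (∀ j, 0 < m j) ∧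
      ∀ (G : Type) [AddCommGroup G] (β : 𝓞 K →+ 𝓞 K →+ G) (a : 𝓞 K),
        ∑ j, m j • β (ε j * a) (ε j) = ∑ j, m j • β (ε j) (ε j * IsCMField.ringOfIntegersComplexConj K a) := by
  classical
  obtain ⟨σ, n, ε, q, hσeq, hσ, hq, hid⟩ := IsCMField.exists_ratWeights_embeddings K
  -- clear denominators: `D := ∏ den(q_j)`, `m_j := D q_j ∈ ℕ`
  let D : ℕ := ∏ j, (q j).den
  have hDpos : 0 < D := Finset.prod_pos fun j _ => (q j).den_pos
  have hden : ∀ j, (q j).den ∣ D := fun j => Finset.dvd_prod_of_mem _ (Finset.mem_univ j)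
  have hnum : ∀ j, 0 < (q j).num := fun j => Rat.num_pos.2 (hq j)
  let m : Fin (n + 1) → ℕ := fun j => (q j).num.toNat * (D / (q j).den)
  have hm : ∀ j, (m j : ℚ) = (D : ℚ) * q j := by
    intro j
    have h1 : (((q j).num.toNat : ℕ) : ℚ) = ((q j).num : ℚ) := by
      have h := Int.toNat_of_nonneg (hnum j).le
      exact_mod_cast h
    have h2 : (((D / (q j).den : ℕ) : ℚ)) = (D : ℚ) / (q j).den :=
      Nat.cast_div (hden j) (Nat.cast_ne_zero.2 (q j).den_ne_zero)
    simp only [m, Nat.cast_mul, h1, h2]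
    conv_rhs => rw [← Rat.num_div_den (q j)]
    ring
  have hmpos : ∀ j, 0 < m j := fun j =>
    Nat.mul_pos (Int.lt_toNat.2 (by exact_mod_cast hnum j))
      (Nat.div_pos (Nat.le_of_dvd hDpos (hden j)) (q j).den_pos)
  -- the identity for every biadditive `β`, over the full index set (zero `ε_j` included)
  have key : ∀ (G : Type) [AddCommGroup G] (β : 𝓞 K →+ 𝓞 K →+ G) (a : 𝓞 K),
      ∑ j, m j • β (ε j * a) (ε j) = ∑ j, m j • β (ε j) (ε j * IsCMField.ringOfIntegersComplexConj K a) := by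
    intro G _ β a
    -- expand `β` in an integral basis
    let B := RingOfIntegers.basis K
    have hβ : ∀ x y : 𝓞 K, β x y = ∑ k, ∑ l, (B.repr x k * B.repr y l) • β (B k) (B l) := by
      intro x y
      have hx : β x y = ∑ k, B.repr x k • β (B k) y := by
        conv_lhs => rw [← B.sum_repr x]
        rw [show β (∑ k, B.repr x k • B k) y = β.flip y (∑ k, B.repr x k • B k) from rfl, map_sum]
        exact Finset.sum_congr rfl fun k _ => by rw [map_zsmul]; rfl
      rw [hx]
      refine Finset.sum_congr rfl fun k _ => ?_
      conv_lhs => rw [← B.sum_repr y]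
      rw [map_sum, Finset.smul_sum]
      exact Finset.sum_congr rfl fun l _ => by rw [map_zsmul, smul_smul]
    -- the coordinate identity, from the ℚ-bilinear identity
    have hcoord : ∀ k l, ∑ j, (m j : ℤ) * (B.repr (ε j * a) k * B.repr (ε j) l) =
        ∑ j, (m j : ℤ) * (B.repr (ε j) k * B.repr (ε j * IsCMField.ringOfIntegersComplexConj K a) l) := by
      intro k l
      -- the ℚ-bilinear coordinate form `f(x, y) = c_k(x) c_l(y)` on `K`, valued in `ℂ`
      let IB := integralBasis K
      let ck : K →ₗ[ℚ] ℂ := (Algebra.linearMap ℚ ℂ).comp (IB.coord k)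
      let cl : K →ₗ[ℚ] ℂ := (Algebra.linearMap ℚ ℂ).comp (IB.coord l)
      let f : K →ₗ[ℚ] K →ₗ[ℚ] ℂ := (LinearMap.mul ℚ ℂ).compl₁₂ ck cl
      have hfapply : ∀ x y : K, f x y = ((IB.repr x k : ℚ) : ℂ) * ((IB.repr y l : ℚ) : ℂ) := fun x y => by
        simp [f, ck, cl, LinearMap.compl₁₂, Algebra.linearMap_apply, eq_ratCast]
      have hmain := sum_mul_bilin_eq_sum_mul_bilin_conj_of_embeddings hσ hid f (a : K)
      have hcast : ∀ (x : 𝓞 K) (i), ((IB.repr (x : K) i : ℚ) : ℂ) = ((B.repr x i : ℤ) : ℂ) := fun x i => by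
        rw [show (x : K) = algebraMap (𝓞 K) K x from rfl, integralBasis_repr_apply]
        simp [B]
      have hconj : ∀ j, ((ε j : 𝓞 K) : K) * σ (a : K) =
          ((ε j * IsCMField.ringOfIntegersComplexConj K a : 𝓞 K) : K) := fun j => by
        rw [hσeq]; push_cast; rfl
      apply Int.cast_injective (α := ℂ)
      push_cast
      have hmq : ∀ j, ((m j : ℕ) : ℂ) = (D : ℂ) * (q j : ℂ) := fun j => by exact_mod_cast hm j
      have hL := congrArg (fun z : ℂ => (D : ℂ) * z) hmain
      simp only [Finset.mul_sum, hfapply] at hL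
      convert hL using 2 with j _ j _
      · rw [hmq, ← hcast, ← hcast]; push_cast; ring
      · rw [hmq, ← hcast, ← hcast, ← hconj]; ring
    have e1 : ∑ j, m j • β (ε j * a) (ε j) =
        ∑ j, ∑ k, m j • ∑ l, (B.repr (ε j * a) k * B.repr (ε j) l) • β (B k) (B l) :=
      Finset.sum_congr rfl fun j _ => by rw [hβ (ε j * a) (ε j), Finset.smul_sum]
    have e2 : ∑ j, m j • β (ε j) (ε j * IsCMField.ringOfIntegersComplexConj K a) =
        ∑ j, ∑ k, m j • ∑ l, (B.repr (ε j) k * B.repr (ε j * IsCMField.ringOfIntegersComplexConj K a) l) •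
          β (B k) (B l) :=
      Finset.sum_congr rfl fun j _ => by
        rw [hβ (ε j) (ε j * IsCMField.ringOfIntegersComplexConj K a), Finset.smul_sum]
    rw [e1, e2]
    rw [Finset.sum_comm]
    conv_rhs => rw [Finset.sum_comm]
    refine Finset.sum_congr rfl fun k _ => ?_
    simp only [Finset.smul_sum]
    rw [Finset.sum_comm]
    conv_rhs => rw [Finset.sum_comm]
    refine Finset.sum_congr rfl fun l _ => ?_
    simp only [← natCast_zsmul, smul_smul, ← Finset.sum_smul]
    rw [hcoord k l]
  -- discard the zero `ε_j`
  have hJ : Nonempty {j : Fin (n + 1) // ε j ≠ 0} := by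
    by_contra hJ
    have h0 : ∀ j, ε j = 0 := fun j => by
      by_contra h; exact hJ ⟨⟨j, h⟩⟩
    obtain ⟨τ₁⟩ : Nonempty (K →ₐ[ℚ] ℂ) := by
      rw [← Fintype.card_pos_iff, AlgHom.card ℚ K ℂ]; exact Module.finrank_pos
    have h1 := (hid τ₁ (τ₁.comp σ)).1 rfl
    simp [h0] at h1
  have hsplit : ∀ {G : Type} [AddCommMonoid G] (g : Fin (n + 1) → G), (∀ j, ε j = 0 → g j = 0) →
      ∑ j, g j = ∑ j : {j : Fin (n + 1) // ε j ≠ 0}, g j.1 := by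
    intro G _ g hg
    rw [← Finset.sum_subtype (Finset.univ.filter fun j => ε j ≠ 0) (by simp) g,
      Finset.sum_filter_of_ne]
    intro j _ hj h0
    exact hj (hg j h0)
  refine ⟨{j : Fin (n + 1) // ε j ≠ 0}, inferInstance, fun j => ε j.1, fun j => m j.1, hJ, fun j => j.2,
    fun j => hmpos j.1, fun G _ β a => ?_⟩
  rw [← hsplit (fun j => m j • β (ε j * a) (ε j)) fun j hj => by simp [hj],
    ← hsplit (fun j => m j • β (ε j) (ε j * IsCMField.ringOfIntegersComplexConj K a)) fun j hj => by simp [hj]]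
  exact key G β a

/-- **Balanced weights, indexed by `Fin (N + 1)`** (the form the divisor-level averaging consumes: Cartier divisors
carry no `Finset.sum`, so the geometric half sums by recursion on `Fin`): the family of
`IsCMField.exists_balancedWeights` re-indexed along `Fintype.equivFin`. [cite: vanGeemen1994HodgeAV, Lemma 5.2 (1) (proof)]
[cite: Deligne1982HodgeCycles, §4 4.3 (a) and Sublemma 4.7] -/
theorem IsCMField.exists_balancedWeights_fin (K : Type) [Field K] [NumberField K] [IsCMField K] :
    ∃ (N : ℕ) (ε : Fin (N + 1) → 𝓞 K) (m : Fin (N + 1) → ℕ), (∀ j, ε j ≠ 0) ∧ (∀ j, 0 < m j) ∧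
      ∀ (G : Type) [AddCommGroup G] (β : 𝓞 K →+ 𝓞 K →+ G) (a : 𝓞 K),
        ∑ j, m j • β (ε j * a) (ε j) = ∑ j, m j • β (ε j) (ε j * IsCMField.ringOfIntegersComplexConj K a) := by
  classical
  obtain ⟨ι, _, ε, m, hne, hε, hm, h⟩ := IsCMField.exists_balancedWeights K
  -- `card ι = N + 1`
  obtain ⟨N, hN⟩ : ∃ N : ℕ, Fintype.card ι = N + 1 :=
    Nat.exists_eq_add_one_of_ne_zero (Fintype.card_ne_zero (α := ι))
  let e : ι ≃ Fin (N + 1) := (Fintype.equivFin ι).trans (finCongr hN)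
  refine ⟨N, fun j => ε (e.symm j), fun j => m (e.symm j), fun j => hε _, fun j => hm _, fun G _ β a => ?_⟩
  have h' := h G β a
  rw [← Fintype.sum_equiv e.symm (fun j => m (e.symm j) • β (ε (e.symm j) * a) (ε (e.symm j)))
      (fun i => m i • β (ε i * a) (ε i)) (fun _ => rfl),
    ← Fintype.sum_equiv e.symm
      (fun j => m (e.symm j) • β (ε (e.symm j)) (ε (e.symm j) * IsCMField.ringOfIntegersComplexConj K a))
      (fun i => m i • β (ε i) (ε i * IsCMField.ringOfIntegersComplexConj K a)) (fun _ => rfl)] at h'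
  exact h'

end BalancedWeights

end Literature.NumberTheory.ComplexMultiplication

end
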